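import Summits.ValiantsHypothesis.ValiantsHypothesis.Theses.ShallowShadows
import Literature.Computability.AlgebraicComplexity.PermanentIrreducible

/-!
# ValiantsHypothesis / ShallowShadows — item `PerZeroOne` (stmt-ValiantsHypothesis-17129)

Every coefficient of `perPoly (Fin m) ℂ` is `0` or `1`: the permanent is `∑_ρ X^{μ_ρ}` over the
permutation monomials `μ_ρ` (`perPoly_eq_sum_monomial`), and distinct permutations give distinct
monomials (`permMonomial_injective`), so a nonzero coefficient is the coefficient `1` of some `μ_ρ`
(`exists_permMonomial_eq_of_coeff_perPoly_ne_zero`, `coeff_permMonomial_perPoly`, all in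
`PermanentIrreducible.lean`). HONEST FRAMING: a support lemma of a dormant route; bookkeeping.
-/

-- layout Summits/ValiantsHypothesis/ValiantsHypothesis forces the duplicated namespace component
set_option linter.dupNamespace false

namespace Summit.ValiantsHypothesis.ValiantsHypothesis.Theorems.ShallowShadows

open Literature.Computability.AlgebraicComplexity MvPolynomial

/-- **Item `PerZeroOne` (stmt-ValiantsHypothesis-17129):** every coefficient of the permanent
polynomial is `0` or `1`. [folklore] -/
theorem perZeroOne_proof : Theses.ShallowShadows.PerZeroOne := by
  unfold Theses.ShallowShadows.PerZeroOne
  intro m mo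
  by_cases h : (perPoly (Fin m) ℂ).coeff mo = 0
  · exact Or.inl h
  · obtain ⟨ρ, rfl⟩ := exists_permMonomial_eq_of_coeff_perPoly_ne_zero ℂ h
    exact Or.inr (coeff_permMonomial_perPoly ℂ ρ)

end Summit.ValiantsHypothesis.ValiantsHypothesis.Theorems.ShallowShadows
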